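import Literature.AlgebraicGeometry.Resolution.CompletedPullbackRegular
import Literature.AlgebraicGeometry.Resolution.GeometricallyRegularFG
import Literature.AlgebraicGeometry.Morphisms.ReducedOfFlat
import Mathlib.FieldTheory.SeparablyGenerated
import Mathlib.AlgebraicGeometry.Morphisms.Flat
import Mathlib.RingTheory.RingHom.FaithfullyFlat
import Mathlib.Algebra.Field.Subfield.Basic

/-!
# `Descent.DescentPerfectToAll`, line `arc-special-fibre-transversality`: the separable robust level

Route `ResolutionOfSingularities/Descent`, crux `DescentPerfectToAll`
(stmt-ResolutionOfSingularities-0549), stub `stub_robustLevelSeparable` of the lead's skeleton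
`work/DescentPerfectToAll.lean` (RESHAPE 2), PROVED here (statement verbatim from the ledger
registration).

**Statement (a robust level when `k` is separable over a finitely generated level).** Let `k` be
a field of characteristic `p`. Assume (i) every reduced separated scheme of finite type over every
finitely generated subfield `L = closure t ⊆ k` has a resolution of singularities, and (ii) for the
given finitely generated `K₀ ⊆ k` and the reduced separated finite-type `f₀ : X₀ → Spec K₀` with
`X₀ ×_{K₀} k` reduced, there is a finitely generated level `K₀ ≤ L = closure t ⊆ k` over which `k`
is separable in MacLane's sense: `L`-linearly independent finite families in `k` have `L`-linearly
independent `p`-th powers. Then some such `L` carries a proper birational `π : Y → X₀ ×_{K₀} L`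
which is ROBUST: for every finitely generated `L ≤ L' = closure t' ⊆ k` there are a field `Ω` and
`φ : L' → Ω` with `Y ×_L Ω` regular.

**Proof.** Take the MacLane-separable level `L` of (ii).
* `Z := X₀ ×_{K₀} L` is reduced: `(X₀ ×_{K₀} L) ×_L k ≅ X₀ ×_{K₀} k` is reduced and the projection
  onto `Z` is flat and surjective (base change of `Spec k → Spec L`), so reducedness descends
  (`isReduced_of_flat_of_surjective`). By (i), `Z` has a resolution `π : Y → Z`.
* Robustness, with `Ω := L'`, `φ := id`: `Y` is regular and locally of finite type over `L`, and
  `L'/L` is finitely generated (`L' = closure t'`) and MacLane-separable (an `L`-linearly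
  independent family in `L'` stays independent in `k`). By Mathlib's
  `exists_isTranscendenceBasis_and_isSeparable_of_linearIndepOn_pow_of_essFiniteType`
  (Stacks 030W) `L'/L` is separably generated: `L ⊆ L(s) ⊆ L'` with `s` algebraically independent
  and `L'/L(s)` finite separable. For an affine open `Spec B ⊆ Y` (`B` regular of finite type over
  `L`), `L(s) ⊗_L B` is regular (a localisation of a polynomial ring over `B`,
  `isRegularRing_tensor_of_algEquiv_fractionRing`) and `L' ⊗_{L(s)} (L(s) ⊗_L B) ≅ L' ⊗_L B` is
  regular (finite separable base change, `IsRegularRing.tensorProduct_of_isSeparable_left`).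
  The charts `Spec (B ⊗_L L') → Y ×_L L'` (`specTensorChart`) cover, so `Y ×_L L'` is regular.
-/

noncomputable section

set_option linter.dupNamespace false -- mandated namespace of this single-conjunct summit

open CategoryTheory CategoryTheory.Limits AlgebraicGeometry TopologicalSpace TensorProduct
  IsLocalRing
open Literature.AlgebraicGeometry.Resolution Literature.AlgebraicGeometry.Morphisms

namespace Summit.ResolutionOfSingularities.ResolutionOfSingularities.Theorems

universe u

/-! ## Ring level: separably generated base change of a regular ring -/

/-- **Base change of a regular ring along a finitely generated MacLane-separable field
extension is regular.** If `L'/L` is essentially of finite type and `L`-linearly independent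
finite families in `L'` have `L`-linearly independent `p`-th powers (`p` the characteristic
exponent), then `L' ⊗_L B` is regular for every regular `L`-algebra `B`: `L'/L` is separably
generated, `L' ⊇ L(s) ⊇ L` (Stacks 030W), `L(s) ⊗_L B` is a localisation of `B[X_s]`, and
`L' ⊗_{L(s)} -` is a finite separable (étale) base change. [cite: StacksProject, Tag 030W] -/
theorem isRegularRing_tensor_of_linearIndepOn_pow (p : ℕ) (hp : p.Prime) (L L' B : Type u)
    [Field L] [ExpChar L p] [Field L'] [Algebra L L'] [Algebra.EssFiniteType L L']
    (H : ∀ s : Finset L', LinearIndepOn L _root_.id (s : Set L') →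
      LinearIndepOn L (· ^ p) (s : Set L'))
    [CommRing B] [Algebra L B] [IsRegularRing B] : IsRegularRing (L' ⊗[L] B) := by
  classical
  obtain ⟨s, hs, hsep⟩ :=
    exists_isTranscendenceBasis_and_isSeparable_of_linearIndepOn_pow_of_essFiniteType p hp H
  -- the purely transcendental part `E = L(s) ≅ L(X_s)`
  let E : IntermediateField L L' := IntermediateField.adjoin L (s : Set L')
  have hrange : IntermediateField.adjoin L (Set.range ((↑) : s → L')) = E := by
    simp only [E, Subtype.range_coe_subtype, Finset.setOf_mem]
  let e₀ : FractionRing (MvPolynomial s L) ≃ₐ[L] E :=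
    hs.1.aevalEquivField.trans (IntermediateField.equivOfEq hrange)
  haveI : IsRegularRing (L ⊗[L] B) :=
    IsRegularRing.of_ringEquiv (R := B) (Algebra.TensorProduct.lid L B).symm.toRingEquiv
  haveI : IsRegularRing (E ⊗[L] B) := isRegularRing_tensor_of_algEquiv_fractionRing L E e₀
  -- the finite separable part `L' / E`
  haveI : Algebra.IsSeparable E L' := hsep
  haveI : Algebra.EssFiniteType E L' := Algebra.EssFiniteType.of_comp L E L'
  haveI : Module.Finite E L' := Algebra.finite_of_essFiniteType_of_isAlgebraic
  -- `L' ⊗_E (E ⊗_L B) ≅ L' ⊗_L B` (finite separable base change; the final descent step of the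
  -- tree lemma is along the identity of `L'`)
  exact isRegularRing_tensor_of_isSeparable_of_descent (k := L) (F := B) E L' L'

/-! ## Finitely generated subfields -/

/-- A finitely generated subfield `L' = closure t'` of `k` is essentially of finite type over any
field mapping to it (it is generated, as a field, by the finitely many elements of `t'`).
[folklore] -/
theorem essFiniteType_of_eq_closure {k : Type u} [Field k] (F : Type u) [Field F]
    (L' : Subfield k) [Algebra F L'] (t' : Finset k)
    (ht' : L' = Subfield.closure (↑t' : Set k)) : Algebra.EssFiniteType F L' := by
  classical
  refine IntermediateField.fg_top_iff.mp ⟨t'.subtype (· ∈ L'), ?_⟩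
  set G := IntermediateField.adjoin F (↑(t'.subtype (· ∈ L')) : Set L') with hG
  rw [eq_top_iff]
  intro z _
  have hle : Subfield.closure (↑t' : Set k) ≤ G.toSubfield.map L'.subtype := by
    rw [Subfield.closure_le]
    intro x hx
    have hxL' : x ∈ L' := by
      rw [ht']
      exact Subfield.subset_closure hx
    refine ⟨⟨x, hxL'⟩, ?_, rfl⟩
    change (⟨x, hxL'⟩ : L') ∈ G
    refine IntermediateField.subset_adjoin F _ ?_
    rw [Finset.mem_coe, Finset.mem_subtype]
    exact hx
  have hz : (z : k) ∈ Subfield.closure (↑t' : Set k) := by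
    rw [← ht']
    exact z.2
  obtain ⟨w, hw, hwz⟩ := Subfield.mem_map.mp (hle hz)
  have hwz' : w = z := Subtype.ext hwz
  rw [← hwz']
  exact hw

/-- MacLane separability restricts to subfields: if `L`-linearly independent finite families in
`k` have `L`-linearly independent `p`-th powers, the same holds in every intermediate subfield
`L ≤ L' ⊆ k`. [folklore] -/
theorem linearIndepOn_pow_of_subfield {k : Type u} [Field k] (L L' : Subfield k) [Algebra L L']
    [IsScalarTower L L' k] (p : ℕ)
    (H : ∀ u : Finset k, LinearIndepOn L _root_.id (↑u : Set k) →
      LinearIndepOn L (fun x : k => x ^ p) (↑u : Set k))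
    (u : Finset L') (hu : LinearIndepOn L _root_.id (↑u : Set L')) :
    LinearIndepOn L (fun x : L' => x ^ p) (↑u : Set L') := by
  classical
  let ψ : L' →ₐ[L] k := IsScalarTower.toAlgHom L L' k
  have hψ : Function.Injective ψ.toLinearMap := ψ.toRingHom.injective
  have h1 : LinearIndepOn L _root_.id (ψ.toLinearMap '' ↑u) := hu.id_imageₛ hψ.injOn
  rw [← Finset.coe_image] at h1
  have h2 := H _ h1
  rw [Finset.coe_image] at h2
  have h3 : LinearIndepOn L ((fun x : k => x ^ p) ∘ ψ.toLinearMap) ↑u :=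
    h2.comp_of_image hψ.injOn
  have h4 : (fun x : k => x ^ p) ∘ ψ.toLinearMap = ψ.toLinearMap ∘ fun x : L' => x ^ p := by
    funext x
    simp
  rw [h4] at h3
  exact h3.of_comp _

/-! ## Scheme level: base change of a regular scheme of finite type over a field -/

/-- **Charts.** Let `q : Y → Spec L` be locally of finite type with `Y` regular, and `E` an
`L`-algebra such that `B ⊗_L E` is regular for every regular `L`-algebra `B` of finite type.
Then `Y ×_L E` is regular: it is covered by the open charts `Spec (Γ(Y, W) ⊗_L E)` over the
affine opens `W` of `Y`, whose rings `Γ(Y, W)` are regular of finite type over `L`. [folklore] -/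
theorem isRegular_pullback_of_forall_isRegularRing_tensor {L : Type u} [Field L] (E : Type u)
    [CommRing E] [Algebra L E]
    (hE : ∀ (B : Type u) [CommRing B] [Algebra L B], Algebra.FiniteType L B →
      IsRegularRing B → IsRegularRing (B ⊗[L] E))
    {Y : Scheme.{u}} (q : Y ⟶ Spec (.of L)) [LocallyOfFiniteType q] (hY : Scheme.IsRegular Y) :
    Scheme.IsRegular (pullback q (specOfAlgebra L E)) := by
  intro y
  -- an affine chart `Spec B ↪ Y` at the image of `y`, `B` of finite type over `L`
  obtain ⟨W, hW, hyW, -⟩ := exists_isAffineOpen_mem_and_subset (X := Y)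
    (x := pullback.fst q (specOfAlgebra L E) y) (U := ⊤) trivial
  let iW : Spec Γ(Y, W) ⟶ Y := hW.fromSpec
  let φ₀ : CommRingCat.of L ⟶ Γ(Y, W) := Spec.preimage (iW ≫ q)
  letI : Algebra L Γ(Y, W) := φ₀.hom.toAlgebra
  have hi : iW ≫ q = Spec.map (CommRingCat.ofHom (algebraMap L Γ(Y, W))) := by
    rw [RingHom.algebraMap_toAlgebra, CommRingCat.ofHom_hom, Spec.map_preimage]
  haveI : Algebra.FiniteType L Γ(Y, W) := by
    have h1 : LocallyOfFiniteType (Spec.map (CommRingCat.ofHom (algebraMap L Γ(Y, W)))) := by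
      rw [← hi]; infer_instance
    have h2 := (HasRingHomProperty.Spec_iff (P := @LocallyOfFiniteType)).mp h1
    exact RingHom.finiteType_algebraMap.mp h2
  -- `B = Γ(Y, W)` is regular: its local rings are local rings of `Y`
  haveI : IsNoetherianRing Γ(Y, W) := Algebra.FiniteType.isNoetherianRing L _
  have hB : IsRegularRing Γ(Y, W) := isRegularRing_iff.mpr fun 𝔭 _ =>
    (isRegularLocalRing_stalk_Spec_iff Γ(Y, W) ⟨𝔭, ‹_›⟩).mp
      ((isRegularLocalRing_stalk_iff_of_isOpenImmersion iW ⟨𝔭, ‹_›⟩).mp (hY _))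
  haveI : IsRegularRing (Γ(Y, W) ⊗[L] E) := hE Γ(Y, W) inferInstance hB
  -- `y` lies in the chart `Spec (B ⊗_L E)`
  let c := specTensorChart E q iW hi
  have hyrange : y ∈ Set.range c := by
    change y ∈ Set.range (specTensorChart E q iW hi)
    rw [range_specTensorChart, Set.mem_preimage, IsAffineOpen.range_fromSpec]
    exact hyW
  obtain ⟨ζ, hζ⟩ := hyrange
  rw [← hζ]
  exact (isRegularLocalRing_stalk_iff_of_isOpenImmersion c ζ).mpr
    ((isRegularLocalRing_stalk_Spec_iff _ ζ).mpr inferInstance)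

/-- **Separable base change of a regular scheme of finite type.** For `q : Y → Spec L` locally of
finite type with `Y` regular and `L'/L` an essentially finite type, MacLane-separable field
extension (characteristic exponent `p`), `Y ×_L L'` is regular. [cite: StacksProject, Tag 030W] -/
theorem isRegular_pullback_of_linearIndepOn_pow (p : ℕ) (hp : p.Prime) {L : Type u} [Field L]
    [ExpChar L p] (L' : Type u) [Field L'] [Algebra L L'] [Algebra.EssFiniteType L L']
    (H : ∀ s : Finset L', LinearIndepOn L _root_.id (s : Set L') →
      LinearIndepOn L (· ^ p) (s : Set L'))
    {Y : Scheme.{u}} (q : Y ⟶ Spec (.of L)) [LocallyOfFiniteType q] (hY : Scheme.IsRegular Y) :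
    Scheme.IsRegular (pullback q (specOfAlgebra L L')) := by
  refine isRegular_pullback_of_forall_isRegularRing_tensor L' (fun B _ _ _ hB => ?_) q hY
  haveI := hB
  haveI := isRegularRing_tensor_of_linearIndepOn_pow p hp L L' B H
  exact IsRegularRing.of_ringEquiv (R := L' ⊗[L] B)
    (Algebra.TensorProduct.comm L L' B).toRingEquiv

/-! ## The stub -/

/-- **Reducedness of an intermediate level.** For subfields `K₀ ≤ L` of `k` and
`f₀ : X₀ → Spec K₀`, if `X₀ ×_{K₀} k` is reduced then so is `X₀ ×_{K₀} L`: the projection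
`(X₀ ×_{K₀} L) ×_L k → X₀ ×_{K₀} L` is flat and surjective with reduced source
`≅ X₀ ×_{K₀} k`. [folklore] -/
theorem isReduced_pullback_inclusion {k : Type u} [Field k] (K₀ L : Subfield k) (hL : K₀ ≤ L)
    {X₀ : Scheme.{u}} (f₀ : X₀ ⟶ Spec (.of K₀))
    [IsReduced (pullback f₀ (Spec.map (CommRingCat.ofHom K₀.subtype)))] :
    IsReduced (pullback f₀ (Spec.map (CommRingCat.ofHom (Subfield.inclusion hL)))) := by
  have hK : L.subtype.comp (Subfield.inclusion hL) = K₀.subtype := RingHom.ext fun _ => rfl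
  have e : Spec.map (CommRingCat.ofHom L.subtype) ≫
      Spec.map (CommRingCat.ofHom (Subfield.inclusion hL)) =
        Spec.map (CommRingCat.ofHom K₀.subtype) := by
    rw [← Spec.map_comp, ← CommRingCat.ofHom_comp, hK]
  let e' := pullbackLeftPullbackSndIso f₀ (Spec.map (CommRingCat.ofHom (Subfield.inclusion hL)))
      (Spec.map (CommRingCat.ofHom L.subtype)) ≪≫ pullback.congrHom rfl e
  haveI : IsReduced (pullback (pullback.snd f₀ (Spec.map (CommRingCat.ofHom
      (Subfield.inclusion hL)))) (Spec.map (CommRingCat.ofHom L.subtype))) :=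
    isReduced_of_isOpenImmersion e'.hom
  have hff : L.subtype.FaithfullyFlat := RingHom.faithfullyFlat_algebraMap_iff.mpr inferInstance
  obtain ⟨_, _⟩ := (flat_and_surjective_SpecMap_iff (CommRingCat.ofHom L.subtype)).mpr hff
  exact isReduced_of_flat_of_surjective (pullback.fst (pullback.snd f₀ (Spec.map
    (CommRingCat.ofHom (Subfield.inclusion hL)))) (Spec.map (CommRingCat.ofHom L.subtype)))

/-- STUB `stub_robustLevelSeparable` (a robust level when `k` is separable over some finitely
generated level): if every reduced separated finite-type scheme over every finitely generated
subfield of `k` has a resolution, and `k` is MacLane-separable over a finitely generated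
`L ⊇ K₀`, then a resolution `π : Y → X₀ ×_{K₀} L` exists at that level and is robust: for every
finitely generated `L ≤ L' ⊆ k`, `Y ×_L L'` is regular (`Ω := L'`, `φ := id`), because `L'/L` is
separably generated. See the module docstring. [cite: StacksProject, Tag 030W] -/
theorem stub_robustLevelSeparable : ∀ (p : ℕ) [Fact p.Prime] (k : Type) [Field k] [CharP k p], (∀ (L : Subfield k) (t : Finset k), L = Subfield.closure (↑t : Set k) → ∀ (Z : Scheme.{0}) (g : Z ⟶ Spec (.of L)), IsSeparated g → LocallyOfFiniteType g → QuasiCompact g → IsReduced Z → Scheme.HasResolution Z) → ∀ (K₀ : Subfield k) (s : Finset k), K₀ = Subfield.closure (↑s : Set k) → ∀ (X₀ : Scheme.{0}) (f₀ : X₀ ⟶ Spec (.of K₀)), IsSeparated f₀ → LocallyOfFiniteType f₀ → QuasiCompact f₀ → IsReduced X₀ → IsReduced (pullback f₀ (Spec.map (CommRingCat.ofHom K₀.subtype))) → (∃ (L : Subfield k) (_ : K₀ ≤ L) (t : Finset k), L = Subfield.closure (↑t : Set k) ∧ ∀ u : Finset k, LinearIndepOn L _root_.id (↑u : Set k) →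 LinearIndepOn L (fun x : k => x ^ p) (↑u : Set k)) → ∃ (L : Subfield k) (hL : K₀ ≤ L) (t : Finset k), L = Subfield.closure (↑t : Set k) ∧ ∃ (Y : Scheme.{0}) (π : Y ⟶ pullback f₀ (Spec.map (CommRingCat.ofHom (Subfield.inclusion hL)))), IsProper π ∧ IsBirational π ∧ ∀ (L' : Subfield k) (hL' : L ≤ L') (t' : Finset k), L' = Subfield.closure (↑t' : Set k) → ∃ (Ω : Type) (_ : Field Ω) (φ : L' →+* Ω), Scheme.IsRegular (pullback (π ≫ pullback.snd f₀ (Spec.map (CommRingCat.ofHom (Subfield.inclusion hL)))) (Spec.map (CommRingCat.ofHom (φ.comp (Subfield.inclusion hL'))))) := by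
  intro p _ k _ _ hlev K₀ s _ X₀ f₀ _ _ _ _ hred hML
  obtain ⟨L, hL, t, hLt, hML⟩ := hML
  -- the level `Z = X₀ ×_{K₀} L` is reduced, separated and of finite type over `L`: resolve it
  haveI := hred
  haveI : IsReduced (pullback f₀ (Spec.map (CommRingCat.ofHom (Subfield.inclusion hL)))) :=
    isReduced_pullback_inclusion K₀ L hL f₀
  obtain ⟨Y, π, hπ⟩ := hlev L t hLt _
    (pullback.snd f₀ (Spec.map (CommRingCat.ofHom (Subfield.inclusion hL))))
    inferInstance inferInstance inferInstance inferInstance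
  haveI := hπ.isProper
  refine ⟨L, hL, t, hLt, Y, π, hπ.isProper, hπ.isBirational, fun L' hL' t' ht' => ?_⟩
  -- robustness: `Y ×_L L'` is regular for every finitely generated `L ≤ L' ⊆ k`
  refine ⟨L', inferInstance, RingHom.id _, ?_⟩
  letI : Algebra L L' := (Subfield.inclusion hL').toAlgebra
  haveI : IsScalarTower L L' k := IsScalarTower.of_algebraMap_eq fun _ => rfl
  haveI : Algebra.EssFiniteType L L' := essFiniteType_of_eq_closure L L' t' ht'
  haveI : ExpChar L p := ExpChar.prime (Fact.out : p.Prime)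
  rw [RingHom.id_comp]
  exact isRegular_pullback_of_linearIndepOn_pow p Fact.out L'
    (linearIndepOn_pow_of_subfield L L' p hML) _ hπ.isRegular

end Summit.ResolutionOfSingularities.ResolutionOfSingularities.Theorems

end
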